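import Summits.Ventures.HSemireg.WedgeHankelRecurrenceRealRootsSubresultant
import Mathlib.Analysis.Matrix.PosDef

/-!
# Venture HSemireg — STIELTJES-POSITIVE SEQUENCES ARE LOG-CONVEX: from the `2 × 2` principal minors of a positive (semi)definite real Hankel section, **`a_{2i} ≥ 0` and `a_{i+j}² ≤ a_{2i} a_{2j}`**
# (`i, j ≤ t`; strict for `H_t(a) ≻ 0`, `i ≠ j`), hence **`H_t(a) ⪰ 0 ∧ H_t(a∘(·+1)) ⪰ 0 ⇒ a_{n+1}² ≤ a_n a_{n+2}` for all `n + 1 ≤ 2t`** (log-convexity of Stieltjes moment sequences), the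
# ratio monotonicity `a_{n+1}/a_n ≤ a_{n+2}/a_{n+1}`, and the census forms with `sigPos H_t = t + 1`

HONEST FRAMING. Part of the Lean index of the computation cell `pub-hsemireg` (seat p10 gen 37, Sunday typer «UNIFORM-IN-n»).
LINEAR ALGEBRA OF REAL HANKEL MATRICES ONLY (`Matrix.PosSemidef ∕ PosDef`, their Mathlib API `submatrix`, `det_nonneg`, `det_pos`, `diag_nonneg`; the lineage's `hankelSq` and N159's bridge to
`sigPos`): no variety, no cohomology theory, no sheaf, no Ext group and no semiregularity map is constructed here; nothing here says that HC / HC_CM / HC_AV holds; no Literature fact (unproved `Prop`)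
is declared or used.  Custodian versions as in `WedgeHankelSiegelIdeal` (1/3).
SOURCE OF THE STATEMENT: folklore of the moment problem (a Stieltjes moment sequence — both `(a_n)` and `(a_{n+1})` Hankel-positive — is log-convex; the usual route to the log-convexity of the
Catalan ∕ Motzkin ∕ Bell numbers, cf. the tree's `Literature/Combinatorics/Enumerative/MotzkinLogConvexity.lean` and `BellNumbersLogConvex.lean`, which argue differently).  I cite no printed locus
and claim none; the content is `det [[a_{2i}, a_{i+j}], [a_{i+j}, a_{2j}]] ≥ 0`.
presearch: «Hankel positive semidefinite log-convex moment sequence» → [tree] the Yang–Mills files `EquipartitionCriticalityRPProbeCriticalityLogConvex` ∕ `HankelDensitySplitting…` use the same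
`2 × 2` Hankel-positivity ⇒ log-convexity step for their own objects (not the lineage's `hankelSq`; nothing importable); corpus hits are background only (Bleher–Its 2001).
DEDUP DISCLOSURE (`rg` of the whole tree + Mathlib, 2026-09-02): no `WedgeHankelRecurrence*` file extracts `2 × 2` minors of `hankelSq` or states log-convexity; N155 ∕ N159 characterise
`sigPos = t + 1` (all leading minors positive ∕ `Matrix.PosDef`) — used here as the bridge.  10 names: 0 hits tree-wide.

WHAT IS IN THE TREE.  N48 `CensusDet`: `hankelSq`; N159 `RealRootsSubresultant`: **`posDef_hankelSq_of_sigPos_eq`**; Mathlib: **`Matrix.PosSemidef.submatrix`** (any reindexing map),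
**`Matrix.PosDef.submatrix`** (injective), **`Matrix.PosSemidef.det_nonneg`**, **`Matrix.PosDef.det_pos`**, `Matrix.PosSemidef.diag_nonneg`, `Matrix.det_fin_two_of`, `Matrix.det_unique`, `div_le_div_iff₀`.
THIS FILE (namespace `Summit.Ventures.HSemireg.Wedge.HankelOuter` continued; PLAIN over N159 + `Mathlib.Analysis.Matrix.PosDef`; 0 definitions):
* §839 `hankelSq_submatrix_pair` (`H_t(a)[{i,j}] = [[a_{2i}, a_{i+j}], [a_{i+j}, a_{2j}]]`), `nonneg_of_posSemidef_hankelSq`, **`sq_le_mul_of_posSemidef_hankelSq`**, **`sq_lt_mul_of_posDef_hankelSq`**,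
  `pos_of_posDef_hankelSq`.
* §840 **`sq_le_mul_of_posSemidef_hankelSq_pair`** (log-convexity), **`sq_lt_mul_of_posDef_hankelSq_pair`** (strict), `div_le_div_of_posDef_hankelSq_pair` (ratio monotonicity).
* §841 `sq_lt_mul_of_sigPos_hankelSq_eq`, `sq_lt_mul_of_sigPos_hankelSq_pair_eq` (census forms).
CAVEATS.  Real sequences; index ranges are those covered by the sections (`i, j ≤ t`, `n + 1 ≤ 2t`).  Nothing Ext-side.  New names only.
-/

namespace Summit.Ventures.HSemireg.Wedge.HankelOuter

open Summit.Ventures.HSemireg.Wedge Summit.Ventures.HSemireg.Wedge.Hankel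

section LogConvex

/-! ## §839. The `2 × 2` principal minors of a positive Hankel section: `a_{2i} ≥ 0` and `a_{i+j}² ≤ a_{2i} a_{2j}` -/

/-- The `2 × 2` principal submatrix of `H_t(a)` on rows ∕ columns `i, j`. [bookkeeping] -/
theorem hankelSq_submatrix_pair {K : Type*} (t : ℕ) (a : ℕ → K) (i j : Fin (t + 1)) :
    (hankelSq K t a).submatrix ![i, j] ![i, j] = !![a (2 * i), a (i + j); a (i + j), a (2 * j)] := by
  ext x y
  fin_cases x <;> fin_cases y <;> simp [hankelSq, Matrix.submatrix_apply, two_mul, add_comm]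

/-- **Even-indexed terms of a Hankel-nonnegative sequence are nonnegative: `H_t(a) ⪰ 0 ⇒ a_{2i} ≥ 0` (`i ≤ t`).** [this file, §839] -/
theorem nonneg_of_posSemidef_hankelSq {t : ℕ} {a : ℕ → ℝ} (h : (hankelSq ℝ t a).PosSemidef) {i : ℕ} (hi : i ≤ t) : 0 ≤ a (2 * i) := by
  have hd := h.diag_nonneg (i := ⟨i, Nat.lt_succ_of_le hi⟩)
  simpa [hankelSq, two_mul] using hd

/-- **The Hankel Cauchy–Schwarz inequality: `H_t(a) ⪰ 0 ⇒ a_{i+j}² ≤ a_{2i} · a_{2j}` (`i, j ≤ t`)** — the `2 × 2` principal minor on rows `i, j` is nonnegative. [this file, §839] -/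
theorem sq_le_mul_of_posSemidef_hankelSq {t : ℕ} {a : ℕ → ℝ} (h : (hankelSq ℝ t a).PosSemidef) {i j : ℕ} (hi : i ≤ t) (hj : j ≤ t) : a (i + j) ^ 2 ≤ a (2 * i) * a (2 * j) := by
  have hm := (h.submatrix ![(⟨i, Nat.lt_succ_of_le hi⟩ : Fin (t + 1)), ⟨j, Nat.lt_succ_of_le hj⟩]).det_nonneg
  rw [hankelSq_submatrix_pair, Matrix.det_fin_two_of] at hm
  nlinarith [hm]

/-- **Strict form: `H_t(a) ≻ 0`, `i ≠ j` ⇒ `a_{i+j}² < a_{2i} · a_{2j}`.** [this file, §839] -/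
theorem sq_lt_mul_of_posDef_hankelSq {t : ℕ} {a : ℕ → ℝ} (h : (hankelSq ℝ t a).PosDef) {i j : ℕ} (hi : i ≤ t) (hj : j ≤ t) (hij : i ≠ j) : a (i + j) ^ 2 < a (2 * i) * a (2 * j) := by
  have hinj : Function.Injective ![(⟨i, Nat.lt_succ_of_le hi⟩ : Fin (t + 1)), ⟨j, Nat.lt_succ_of_le hj⟩] := by
    intro x y hxy
    fin_cases x <;> fin_cases y
    · rfl
    · exact absurd (congrArg Fin.val hxy) (by simpa using hij)
    · exact absurd (congrArg Fin.val hxy) (by simpa using Ne.symm hij)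
    · rfl
  have hm := (h.submatrix hinj).det_pos
  rw [hankelSq_submatrix_pair, Matrix.det_fin_two_of] at hm
  nlinarith [hm]

/-- **`H_t(a) ≻ 0 ⇒ a_{2i} > 0` (`i ≤ t`).** [this file, §839] -/
theorem pos_of_posDef_hankelSq {t : ℕ} {a : ℕ → ℝ} (h : (hankelSq ℝ t a).PosDef) {i : ℕ} (hi : i ≤ t) : 0 < a (2 * i) := by
  have hd := (h.submatrix (e := fun _ : Fin 1 => (⟨i, Nat.lt_succ_of_le hi⟩ : Fin (t + 1))) (fun x y _ => Subsingleton.elim x y)).det_pos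
  rw [Matrix.det_unique] at hd
  simpa [hankelSq, two_mul] using hd

/-! ## §840. STIELTJES-POSITIVE SEQUENCES ARE LOG-CONVEX: if `H_t(a) ⪰ 0` and `H_t(a ∘ (·+1)) ⪰ 0` then `a_{n+1}² ≤ a_n a_{n+2}` for all `n ≤ 2t − 1` -/

/-- **LOG-CONVEXITY: `H_t(a) ⪰ 0` and `H_t(n ↦ a_{n+1}) ⪰ 0` ⇒ `a_{n+1}² ≤ a_n · a_{n+2}` for every `n + 1 ≤ 2t`** (even `n = 2i`: the minor of `H_t(a)` on rows `i, i+1`; odd `n = 2i+1`: the minor of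
`H_t(a∘(·+1))` on rows `i, i+1`).  This is the standard route to the log-convexity of Stieltjes moment sequences (Catalan, Motzkin, Bell, … numbers). [this file, §840] -/
theorem sq_le_mul_of_posSemidef_hankelSq_pair {t : ℕ} {a : ℕ → ℝ} (h0 : (hankelSq ℝ t a).PosSemidef) (h1 : (hankelSq ℝ t fun n => a (n + 1)).PosSemidef) {n : ℕ} (hn : n + 1 ≤ 2 * t) :
    a (n + 1) ^ 2 ≤ a n * a (n + 2) := by
  obtain ⟨i, rfl | rfl⟩ := Nat.even_or_odd' n
  · have h := sq_le_mul_of_posSemidef_hankelSq h0 (i := i) (j := i + 1) (by omega) (by omega)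
    rw [show i + (i + 1) = 2 * i + 1 by ring, show 2 * (i + 1) = 2 * i + 2 by ring] at h
    exact h
  · have h := sq_le_mul_of_posSemidef_hankelSq h1 (i := i) (j := i + 1) (by omega) (by omega)
    rw [show i + (i + 1) + 1 = 2 * i + 1 + 1 by ring, show 2 * (i + 1) + 1 = 2 * i + 1 + 2 by ring] at h
    exact h

/-- **Strict log-convexity from strict positivity: `H_t(a) ≻ 0`, `H_t(a∘(·+1)) ≻ 0` ⇒ `a_{n+1}² < a_n · a_{n+2}` (`n + 1 ≤ 2t`).** [this file, §840] -/
theorem sq_lt_mul_of_posDef_hankelSq_pair {t : ℕ} {a : ℕ → ℝ} (h0 : (hankelSq ℝ t a).PosDef) (h1 : (hankelSq ℝ t fun n => a (n + 1)).PosDef) {n : ℕ} (hn : n + 1 ≤ 2 * t) :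
    a (n + 1) ^ 2 < a n * a (n + 2) := by
  obtain ⟨i, rfl | rfl⟩ := Nat.even_or_odd' n
  · have h := sq_lt_mul_of_posDef_hankelSq h0 (i := i) (j := i + 1) (by omega) (by omega) (by omega)
    rw [show i + (i + 1) = 2 * i + 1 by ring, show 2 * (i + 1) = 2 * i + 2 by ring] at h
    exact h
  · have h := sq_lt_mul_of_posDef_hankelSq h1 (i := i) (j := i + 1) (by omega) (by omega) (by omega)
    rw [show i + (i + 1) + 1 = 2 * i + 1 + 1 by ring, show 2 * (i + 1) + 1 = 2 * i + 1 + 2 by ring] at h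
    exact h

/-- **Ratio monotonicity: under the same hypotheses and positivity of the terms, `a_{n+1}/a_n ≤ a_{n+2}/a_{n+1}`.** [this file, §840] -/
theorem div_le_div_of_posDef_hankelSq_pair {t : ℕ} {a : ℕ → ℝ} (h0 : (hankelSq ℝ t a).PosDef) (h1 : (hankelSq ℝ t fun n => a (n + 1)).PosDef) {n : ℕ} (hn : n + 2 ≤ 2 * t) :
    a (n + 1) / a n ≤ a (n + 2) / a (n + 1) := by
  have hpos : ∀ m, m ≤ 2 * t + 1 → 0 < a m := fun m hm => by
    obtain ⟨i, rfl | rfl⟩ := Nat.even_or_odd' m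
    · exact pos_of_posDef_hankelSq h0 (by omega)
    · have := pos_of_posDef_hankelSq h1 (i := i) (by omega); simpa [two_mul, add_assoc] using this
  rw [div_le_div_iff₀ (hpos n (by omega)) (hpos (n + 1) (by omega))]
  nlinarith [sq_lt_mul_of_posDef_hankelSq_pair h0 h1 (n := n) (by omega)]

/-! ## §841. The census forms (`sigPos H_t = t + 1`, N159 `posDef_hankelSq_of_sigPos_eq`) -/

/-- **`sigPos H_t(a) = t + 1 ⇒ a_{i+j}² < a_{2i} a_{2j}` for `i ≠ j ≤ t`, and `a_{2i} > 0`.** [this file, §841] -/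
theorem sq_lt_mul_of_sigPos_hankelSq_eq {t : ℕ} {a : ℕ → ℝ} (h : sigPos (hankelSq ℝ t a).toQuadraticForm' = t + 1) {i j : ℕ} (hi : i ≤ t) (hj : j ≤ t) (hij : i ≠ j) :
    a (i + j) ^ 2 < a (2 * i) * a (2 * j) ∧ 0 < a (2 * i) :=
  ⟨sq_lt_mul_of_posDef_hankelSq (posDef_hankelSq_of_sigPos_eq a h) hi hj hij, pos_of_posDef_hankelSq (posDef_hankelSq_of_sigPos_eq a h) hi⟩

/-- **`sigPos H_t(a) = sigPos H_t(a∘(·+1)) = t + 1 ⇒ a` is strictly log-convex up to index `2t + 1`.** [this file, §841] -/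
theorem sq_lt_mul_of_sigPos_hankelSq_pair_eq {t : ℕ} {a : ℕ → ℝ} (h0 : sigPos (hankelSq ℝ t a).toQuadraticForm' = t + 1) (h1 : sigPos (hankelSq ℝ t fun n => a (n + 1)).toQuadraticForm' = t + 1)
    {n : ℕ} (hn : n + 1 ≤ 2 * t) : a (n + 1) ^ 2 < a n * a (n + 2) :=
  sq_lt_mul_of_posDef_hankelSq_pair (posDef_hankelSq_of_sigPos_eq a h0) (posDef_hankelSq_of_sigPos_eq _ h1) hn

end LogConvex

end Summit.Ventures.HSemireg.Wedge.HankelOuter
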